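import Mathlib
import HarnessLib
import Summits.HubbardSuperconductivity.HubbardSuperconductivity.Theorems.KLProgrammeH10TwoPointLimitPerturbedCountFold

/-!
# Route `KLProgramme` — crux K1 `H10TwoPointLimit` (stmt-HubbardSuperconductivity-19938):
# periodicity and derivative formulas of the perturbed level function along the counting fibres

The curve-generic counting lemmas of the tree (`gridCount_L2…L5`, `dyadic_total` in `HubbardBandSectorCountingToolbox/Counts`)
consume, besides the non-degeneracy lemmas (landed for the perturbed curve: `cover_perturbed`, `odd_transversal_perturbed`,
`even_key_perturbed`, `diag_strat_perturbed`), only calculus bookkeeping about the level function along the fibres `θ₃ ↦ h`,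
the shift lines `x ↦ h(x, x + c)`, the anti-diagonals `t ↦ h(σ - t/2, σ + t/2)` and the diagonal `x ↦ h(x, x)`. This file supplies,
for the perturbed level function `h^E` of `KLProgrammePerturbedCountDefs.lean` (port step (3) of HOME/prover-p4/PORT-NOTE.md §6; the
lineage's `KLProgrammeCountPairsOffsetDeriv.lean` §§Periodic/Deriv on the moving curve):

* `2π`-periodicity of `h^E`, `∂₃h^E` in each angle (`hfunE_add_int_mul_two_pi_*`, `h3E_add_int_mul_two_pi_*`);
* `hasDerivAt_hfunE_shift` (`(d/dx) h^E(x, x+c) = ∂₂h^E + ∂₃h^E = h3E(x+c,x) + h3E(x,x+c)`), `hasDerivAt_hfunE_diagZero`,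
  `hasDerivAt_hfunE_anti` (the closed form that `even_key_perturbed` bounds from below), `hasDerivAt_two_h3E_diag` (the diagonal
  SECOND derivative with its `4D²δ(S)[p_E',p_E'] + 2Dδ(S)[p_E'']` term — the closed form `diag_strat_perturbed` bounds from below);
* three lines of generic bookkeeping (`abs_two_sin_mul_sub_le`, `norm_vec2_sub_le`, `abs_fderiv_apply_sub_le` — the `κ₂`-Lipschitz
  property of `Dδ` for a `C²` perturbation) used by the Lipschitz estimates of `…PerturbedCountLipschitz.lean`.

Everything is PROVED; no definitions. References: BGM 2006 Lemma 3.1 / App. A2 [cite: BenfattoGiulianiMastropietro2006].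
-/

noncomputable section

namespace Summit.HubbardSuperconductivity.HubbardSuperconductivity.Theorems.PerturbedFermiCurve

set_option linter.dupNamespace false -- summit = problem name (single-conjunct summit), D-0017

open Real Set
open Literature.MathematicalPhysics.QuantumLattice Literature.MathematicalPhysics.QuantumLattice.BandSectorCounting

/-! ## §0 Generic real-analysis bookkeeping -/

/-- `|2 sin s·v - 2 sin s'·v'| ≤ 2(e_S M_V + e_V)` from `|s - s'| ≤ e_S`, `|v - v'| ≤ e_V`, `|v| ≤ M_V`. [folklore] -/
theorem abs_two_sin_mul_sub_le {s s' v v' eS eV MV : ℝ} (hS : |s - s'| ≤ eS) (hV : |v - v'| ≤ eV) (hVb : |v| ≤ MV) :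
    |2 * Real.sin s * v - 2 * Real.sin s' * v'| ≤ 2 * (eS * MV + eV) := by
  have h1 : |Real.sin s - Real.sin s'| ≤ eS := (Real.abs_sin_sub_sin_le _ _).trans hS
  have heS : 0 ≤ eS := (abs_nonneg _).trans hS
  have hid : 2 * Real.sin s * v - 2 * Real.sin s' * v' = 2 * ((Real.sin s - Real.sin s') * v + Real.sin s' * (v - v')) := by ring
  rw [hid, abs_mul, abs_two]
  have h2 := abs_add_le ((Real.sin s - Real.sin s') * v) (Real.sin s' * (v - v'))
  rw [abs_mul, abs_mul] at h2
  have h3 : |Real.sin s - Real.sin s'| * |v| ≤ eS * MV := mul_le_mul h1 hVb (abs_nonneg _) heS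
  have h4 : |Real.sin s'| * |v - v'| ≤ 1 * eV := mul_le_mul (Real.abs_sin_le_one _) hV (abs_nonneg _) zero_le_one
  linarith

/-- The sup norm of a difference of pairs. [folklore] -/
theorem norm_vec2_sub_le {a₁ a₂ b₁ b₂ M : ℝ} (hM : 0 ≤ M) (h₁ : |a₁ - b₁| ≤ M) (h₂ : |a₂ - b₂| ≤ M) :
    ‖(![a₁, a₂] : Fin 2 → ℝ) - ![b₁, b₂]‖ ≤ M := by
  have e : (![a₁, a₂] : Fin 2 → ℝ) - ![b₁, b₂] = ![a₁ - b₁, a₂ - b₂] := by ext i; fin_cases i <;> simp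
  rw [e]; exact norm_vec2_le hM h₁ h₂

/-- **`Dδ(p)[v] - Dδ(p')[v']`** for a `C²` function with `‖Dδ‖ ≤ κ₁`, `‖D(Dδ)‖ ≤ κ₂`: `≤ κ₁‖v - v'‖ + κ₂‖p - p'‖‖v'‖`. [folklore] -/
theorem abs_fderiv_apply_sub_le {δ : (Fin 2 → ℝ) → ℝ} (hδs : ContDiff ℝ 2 δ) {κ₁ κ₂ : ℝ}
    (hκ : ∀ k : Fin 2 → ℝ, ‖fderiv ℝ δ k‖ ≤ κ₁) (hκ₂ : ∀ k : Fin 2 → ℝ, ‖fderiv ℝ (fderiv ℝ δ) k‖ ≤ κ₂)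
    (p p' v v' : Fin 2 → ℝ) :
    |fderiv ℝ δ p v - fderiv ℝ δ p' v'| ≤ κ₁ * ‖v - v'‖ + κ₂ * ‖p - p'‖ * ‖v'‖ := by
  have hd : ∀ k : Fin 2 → ℝ, DifferentiableAt ℝ (fderiv ℝ δ) k := by
    have h : ContDiff ℝ 1 (fderiv ℝ δ) := hδs.fderiv_right (by rw [one_add_one_eq_two])
    exact fun k => (h.differentiable one_ne_zero) k
  have hL : ‖fderiv ℝ δ p - fderiv ℝ δ p'‖ ≤ κ₂ * ‖p - p'‖ :=
    (convex_univ (𝕜 := ℝ) (E := Fin 2 → ℝ)).norm_image_sub_le_of_norm_fderiv_le (fun k _ => hd k) (fun k _ => hκ₂ k)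
      (mem_univ p') (mem_univ p)
  have hid : fderiv ℝ δ p v - fderiv ℝ δ p' v' = fderiv ℝ δ p (v - v') + (fderiv ℝ δ p - fderiv ℝ δ p') v' := by
    rw [map_sub, sub_apply]; ring
  rw [hid]
  refine (abs_add_le _ _).trans (add_le_add ?_ ?_)
  · rw [← Real.norm_eq_abs]
    exact ((fderiv ℝ δ p).le_opNorm _).trans (mul_le_mul_of_nonneg_right (hκ p) (norm_nonneg _))
  · rw [← Real.norm_eq_abs]
    exact ((fderiv ℝ δ p - fderiv ℝ δ p').le_opNorm _).trans (mul_le_mul_of_nonneg_right hL (norm_nonneg _))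

section Fibres

variable {a b : ℝ} (B : BandBounds a b) {δ : (Fin 2 → ℝ) → ℝ} (hδs : ContDiff ℝ 2 δ)
  {κ₀ κ₁ μ : ℝ} (hδ : ∀ k : Fin 2 → ℝ, |δ k| ≤ κ₀) (hlo : a ≤ μ - κ₀) (hhi : μ + κ₀ ≤ b)
  (hκ : ∀ k : Fin 2 → ℝ, ‖fderiv ℝ δ k‖ ≤ κ₁) (hκ₁ : κ₁ < B.Dtmin)
  {u : ℝ → ℝ} (hu : ∀ θ, IsBandFermiRadius (μ - δ (u θ • dir θ)) θ (u θ))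
include B hδs hδ hlo hhi hκ hκ₁ hu

/-! ## §1 Periodicity -/

/-- **`2π`-periodicity of the perturbed curve and its velocity under integer multiples.** [folklore] -/
theorem curve_add_int_mul_two_pi (θ : ℝ) (m : ℤ) :
    XE u (θ + m * (2 * π)) = XE u θ ∧ YE u (θ + m * (2 * π)) = YE u θ ∧
      VXE u (θ + m * (2 * π)) = VXE u θ ∧ VYE u (θ + m * (2 * π)) = VYE u θ := by
  have h2ne : (2 : WithTop ℕ∞) ≠ 0 := by norm_num
  have hδ' : ∀ k : Fin 2 → ℝ, (∀ i, |k i| ≤ π) → |δ k| ≤ κ₀ := fun k _ => hδ k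
  have hκ' : ∀ k : Fin 2 → ℝ, (∀ i, |k i| ≤ π) → ‖fderiv ℝ δ k‖ ≤ κ₁ := fun k _ => hκ k
  have hd' : ∀ k : Fin 2 → ℝ, (∀ i, |k i| ≤ π) → DifferentiableAt ℝ δ k := fun k _ => (hδs.differentiable h2ne) k
  have hper : ∀ ϑ, u (ϑ + m * (2 * π)) = u ϑ := fun ϑ => root_add_int_mul_two_pi B hδ' hlo hhi hd' hκ' hκ₁ hu ϑ m
  have hder : deriv u (θ + m * (2 * π)) = deriv u θ := by
    have hfun : (fun ϑ => u (ϑ + m * (2 * π))) = u := funext hper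
    have h := congrArg (fun f => deriv f θ) hfun
    simp only [deriv_comp_add_const] at h
    exact h
  simp only [XE, YE, VXE, VYE, hper, hder, Real.cos_add_int_mul_two_pi, Real.sin_add_int_mul_two_pi]
  exact ⟨trivial, trivial, trivial, trivial⟩

/-- `h^E` is `2π`-periodic in `θ₃`. [folklore] -/
theorem hfunE_add_int_mul_two_pi_three (P : ℝ × ℝ) (θ₂ θ₃ : ℝ) (m : ℤ) :
    hfunE δ u μ P θ₂ (θ₃ + m * (2 * π)) = hfunE δ u μ P θ₂ θ₃ := by
  obtain ⟨hx, hy, -, -⟩ := curve_add_int_mul_two_pi B hδs hδ hlo hhi hκ hκ₁ hu θ₃ m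
  simp only [hfunE, momE, SXE, SYE, hx, hy]

/-- `h^E` is `2π`-periodic in `θ₂`. [folklore] -/
theorem hfunE_add_int_mul_two_pi_two (P : ℝ × ℝ) (θ₂ θ₃ : ℝ) (m : ℤ) :
    hfunE δ u μ P (θ₂ + m * (2 * π)) θ₃ = hfunE δ u μ P θ₂ θ₃ := by
  rw [hfunE_swap, hfunE_add_int_mul_two_pi_three B hδs hδ hlo hhi hκ hκ₁ hu, hfunE_swap]

/-- `∂₃h^E` is `2π`-periodic in `θ₃`. [folklore] -/
theorem h3E_add_int_mul_two_pi_three (P : ℝ × ℝ) (θ₂ θ₃ : ℝ) (m : ℤ) :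
    h3E δ u P θ₂ (θ₃ + m * (2 * π)) = h3E δ u P θ₂ θ₃ := by
  obtain ⟨hx, hy, hvx, hvy⟩ := curve_add_int_mul_two_pi B hδs hδ hlo hhi hκ hκ₁ hu θ₃ m
  simp only [h3E, momE, SXE, SYE, hx, hy, hvx, hvy]

/-- `∂₃h^E` is `2π`-periodic in `θ₂`. [folklore] -/
theorem h3E_add_int_mul_two_pi_two (P : ℝ × ℝ) (θ₂ θ₃ : ℝ) (m : ℤ) :
    h3E δ u P (θ₂ + m * (2 * π)) θ₃ = h3E δ u P θ₂ θ₃ := by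
  obtain ⟨hx, hy, -, -⟩ := curve_add_int_mul_two_pi B hδs hδ hlo hhi hκ hκ₁ hu θ₂ m
  simp only [h3E, momE, SXE, SYE, hx, hy]

/-! ## §2 Derivative formulas along the fibres -/

/-- A root selection is `C²`, hence differentiable with differentiable derivative. [folklore] -/
theorem differentiableAt_root_and_deriv (x : ℝ) : DifferentiableAt ℝ u x ∧ DifferentiableAt ℝ (deriv u) x := by
  have h2ne : (2 : WithTop ℕ∞) ≠ 0 := by norm_num
  have hu2 : ContDiff ℝ 2 u := contDiff_of_isRoot B hδs h2ne (fun k _ => hδ k) hlo hhi (fun k _ => hκ k) hκ₁ hu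
  have h2 : ContDiff ℝ ((1 : WithTop ℕ∞) + 1) u := by rw [one_add_one_eq_two]; exact hu2
  have h : ContDiff ℝ 1 (deriv u) := (contDiff_succ_iff_deriv.1 h2).2.2
  exact ⟨(hu2.differentiable h2ne) x, (h.differentiable one_ne_zero) x⟩

/-- **The shift-line derivative**: `(d/dx) h^E(x, x + c) = ∂₂h^E + ∂₃h^E = h3E(x+c, x) + h3E(x, x+c)`. [folklore] -/
theorem hasDerivAt_hfunE_shift (P : ℝ × ℝ) (c x : ℝ) :
    HasDerivAt (fun x => hfunE δ u μ P x (x + c)) (h3E δ u P (x + c) x + h3E δ u P x (x + c)) x := by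
  have h2ne : (2 : WithTop ℕ∞) ≠ 0 := by norm_num
  have hud : ∀ z, DifferentiableAt ℝ u z := fun z => (differentiableAt_root_and_deriv B hδs hδ hlo hhi hκ hκ₁ hu z).1
  have hX : HasDerivAt (fun x => SXE u P x (x + c)) (VXE u x + VXE u (x + c)) x := by
    unfold SXE
    exact ((hasDerivAt_XE (hud x)).const_add _).add ((hasDerivAt_XE (hud (x + c))).comp_add_const x c)
  have hY : HasDerivAt (fun x => SYE u P x (x + c)) (VYE u x + VYE u (x + c)) x := by
    unfold SYE
    exact ((hasDerivAt_YE (hud x)).const_add _).add ((hasDerivAt_YE (hud (x + c))).comp_add_const x c)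
  have hfree : HasDerivAt (fun x => eps2 (SXE u P x (x + c)) (SYE u P x (x + c)))
      (2 * Real.sin (SXE u P x (x + c)) * (VXE u x + VXE u (x + c)) +
        2 * Real.sin (SYE u P x (x + c)) * (VYE u x + VYE u (x + c))) x := by
    have h := (hX.cos.add hY.cos).const_mul (-2)
    unfold eps2
    exact h.congr_deriv (by ring)
  have hmom : HasDerivAt (fun x => momE u P x (x + c)) ![VXE u x + VXE u (x + c), VYE u x + VYE u (x + c)] x := by
    refine hasDerivAt_pi.2 fun i => ?_
    fin_cases i
    · simpa [momE] using hX
    · simpa [momE] using hY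
  have hpert : HasDerivAt (fun x => δ (momE u P x (x + c)))
      (fderiv ℝ δ (momE u P x (x + c)) ![VXE u x + VXE u (x + c), VYE u x + VYE u (x + c)]) x :=
    ((hδs.differentiable h2ne) _).hasFDerivAt.comp_hasDerivAt x hmom
  have h := (hfree.add hpert).sub_const μ
  unfold hfunE
  refine h.congr_deriv ?_
  unfold h3E
  rw [SXE_swap u P (x + c) x, SYE_swap u P (x + c) x, momE_swap u P (x + c) x, ← clm_vec2_add]
  ring

/-- **The diagonal derivative**: `(d/dx) h^E(x, x) = 2 ∂₃h^E(x, x)`. [folklore] -/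
theorem hasDerivAt_hfunE_diagZero (P : ℝ × ℝ) (x : ℝ) :
    HasDerivAt (fun x => hfunE δ u μ P x x) (2 * h3E δ u P x x) x := by
  have h := hasDerivAt_hfunE_shift B hδs hδ hlo hhi hκ hκ₁ hu P 0 x
  simp only [add_zero] at h
  exact h.congr_deriv (by ring)

/-- **The anti-diagonal derivative**: `(d/dt) h^E(σ - t/2, σ + t/2) = sin S_x (X_E'(σ+t/2) - X_E'(σ-t/2)) + sin S_y (Y_E'(σ+t/2) - Y_E'(σ-t/2))
 + Dδ(S)[(p_E'(σ+t/2) - p_E'(σ-t/2))/2]` (the closed form bounded below by `even_key_perturbed`). [folklore] -/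
theorem hasDerivAt_hfunE_anti (P : ℝ × ℝ) (σ t : ℝ) :
    HasDerivAt (fun s => hfunE δ u μ P (σ - s / 2) (σ + s / 2))
      (Real.sin (SXE u P (σ - t / 2) (σ + t / 2)) * (VXE u (σ + t / 2) - VXE u (σ - t / 2)) +
        Real.sin (SYE u P (σ - t / 2) (σ + t / 2)) * (VYE u (σ + t / 2) - VYE u (σ - t / 2)) +
        fderiv ℝ δ (momE u P (σ - t / 2) (σ + t / 2))
          ![(VXE u (σ + t / 2) - VXE u (σ - t / 2)) / 2, (VYE u (σ + t / 2) - VYE u (σ - t / 2)) / 2]) t := by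
  have h2ne : (2 : WithTop ℕ∞) ≠ 0 := by norm_num
  have hud : ∀ z, DifferentiableAt ℝ u z := fun z => (differentiableAt_root_and_deriv B hδs hδ hlo hhi hκ hκ₁ hu z).1
  have hm : HasDerivAt (fun s : ℝ => σ - s / 2) (-(1 / 2)) t := by
    have := ((hasDerivAt_id' t).div_const 2).const_sub σ
    exact this.congr_deriv (by ring)
  have hp : HasDerivAt (fun s : ℝ => σ + s / 2) (1 / 2) t := by
    have := ((hasDerivAt_id' t).div_const 2).const_add σ
    exact this.congr_deriv (by ring)
  have hXm : HasDerivAt (fun s => XE u (σ - s / 2)) (VXE u (σ - t / 2) * (-(1 / 2))) t := (hasDerivAt_XE (hud _)).comp t hm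
  have hXp : HasDerivAt (fun s => XE u (σ + s / 2)) (VXE u (σ + t / 2) * (1 / 2)) t := (hasDerivAt_XE (hud _)).comp t hp
  have hYm : HasDerivAt (fun s => YE u (σ - s / 2)) (VYE u (σ - t / 2) * (-(1 / 2))) t := (hasDerivAt_YE (hud _)).comp t hm
  have hYp : HasDerivAt (fun s => YE u (σ + s / 2)) (VYE u (σ + t / 2) * (1 / 2)) t := (hasDerivAt_YE (hud _)).comp t hp
  have hX : HasDerivAt (fun s => SXE u P (σ - s / 2) (σ + s / 2))
      (VXE u (σ - t / 2) * (-(1 / 2)) + VXE u (σ + t / 2) * (1 / 2)) t := by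
    unfold SXE; exact (hXm.const_add _).add hXp
  have hY : HasDerivAt (fun s => SYE u P (σ - s / 2) (σ + s / 2))
      (VYE u (σ - t / 2) * (-(1 / 2)) + VYE u (σ + t / 2) * (1 / 2)) t := by
    unfold SYE; exact (hYm.const_add _).add hYp
  have hfree : HasDerivAt (fun s => eps2 (SXE u P (σ - s / 2) (σ + s / 2)) (SYE u P (σ - s / 2) (σ + s / 2)))
      (Real.sin (SXE u P (σ - t / 2) (σ + t / 2)) * (VXE u (σ + t / 2) - VXE u (σ - t / 2)) +
        Real.sin (SYE u P (σ - t / 2) (σ + t / 2)) * (VYE u (σ + t / 2) - VYE u (σ - t / 2))) t := by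
    have h := (hX.cos.add hY.cos).const_mul (-2)
    unfold eps2
    exact h.congr_deriv (by ring)
  have hmom : HasDerivAt (fun s => momE u P (σ - s / 2) (σ + s / 2))
      ![(VXE u (σ + t / 2) - VXE u (σ - t / 2)) / 2, (VYE u (σ + t / 2) - VYE u (σ - t / 2)) / 2] t := by
    refine hasDerivAt_pi.2 fun i => ?_
    fin_cases i
    · have e : VXE u (σ - t / 2) * (-(1 / 2)) + VXE u (σ + t / 2) * (1 / 2) = (VXE u (σ + t / 2) - VXE u (σ - t / 2)) / 2 := by ring
      show HasDerivAt (fun s => SXE u P (σ - s / 2) (σ + s / 2)) ((VXE u (σ + t / 2) - VXE u (σ - t / 2)) / 2) t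
      exact hX.congr_deriv e
    · have e : VYE u (σ - t / 2) * (-(1 / 2)) + VYE u (σ + t / 2) * (1 / 2) = (VYE u (σ + t / 2) - VYE u (σ - t / 2)) / 2 := by ring
      show HasDerivAt (fun s => SYE u P (σ - s / 2) (σ + s / 2)) ((VYE u (σ + t / 2) - VYE u (σ - t / 2)) / 2) t
      exact hY.congr_deriv e
  have hpert : HasDerivAt (fun s => δ (momE u P (σ - s / 2) (σ + s / 2)))
      (fderiv ℝ δ (momE u P (σ - t / 2) (σ + t / 2))
        ![(VXE u (σ + t / 2) - VXE u (σ - t / 2)) / 2, (VYE u (σ + t / 2) - VYE u (σ - t / 2)) / 2]) t :=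
    ((hδs.differentiable h2ne) _).hasFDerivAt.comp_hasDerivAt t hmom
  have h := (hfree.add hpert).sub_const μ
  unfold hfunE
  exact h

/-- **The diagonal second derivative**: `(d/dx)(2∂₃h^E(x,x)) = 8(cos S_x X_E'² + cos S_y Y_E'²) + 4(sin S_x X_E'' + sin S_y Y_E'')
 + 4D²δ(S)[p_E', p_E'] + 2Dδ(S)[p_E'']` (the closed form bounded below by `diag_strat_perturbed`). [folklore] -/
theorem hasDerivAt_two_h3E_diag (P : ℝ × ℝ) (x : ℝ) :
    HasDerivAt (fun x => 2 * h3E δ u P x x)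
      (8 * (Real.cos (SXE u P x x) * VXE u x ^ 2 + Real.cos (SYE u P x x) * VYE u x ^ 2) +
        4 * (Real.sin (SXE u P x x) * (deriv (deriv u) x * Real.cos x - 2 * deriv u x * Real.sin x - u x * Real.cos x) +
          Real.sin (SYE u P x x) * (deriv (deriv u) x * Real.sin x + 2 * deriv u x * Real.cos x - u x * Real.sin x)) +
        (4 * fderiv ℝ (fderiv ℝ δ) (momE u P x x) ![VXE u x, VYE u x] ![VXE u x, VYE u x] +
          2 * fderiv ℝ δ (momE u P x x) ![(deriv (deriv u) x * Real.cos x - 2 * deriv u x * Real.sin x - u x * Real.cos x),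
            (deriv (deriv u) x * Real.sin x + 2 * deriv u x * Real.cos x - u x * Real.sin x)])) x := by
  have h2ne : (2 : WithTop ℕ∞) ≠ 0 := by norm_num
  obtain ⟨hud, hud'⟩ := differentiableAt_root_and_deriv B hδs hδ hlo hhi hκ hκ₁ hu x
  have hudz : ∀ z, DifferentiableAt ℝ u z := fun z => (differentiableAt_root_and_deriv B hδs hδ hlo hhi hκ hκ₁ hu z).1
  have hδ'd : DifferentiableAt ℝ (fderiv ℝ δ) (momE u P x x) := by
    have h : ContDiff ℝ 1 (fderiv ℝ δ) := hδs.fderiv_right (by rw [one_add_one_eq_two])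
    exact (h.differentiable one_ne_zero) _
  have hX : HasDerivAt (fun x => SXE u P x x) (2 * VXE u x) x := by
    unfold SXE
    exact (((hasDerivAt_XE hud).const_add P.1).add (hasDerivAt_XE hud)).congr_deriv (by ring)
  have hY : HasDerivAt (fun x => SYE u P x x) (2 * VYE u x) x := by
    unfold SYE
    exact (((hasDerivAt_YE hud).const_add P.2).add (hasDerivAt_YE hud)).congr_deriv (by ring)
  have hVX := hasDerivAt_VXE hud hud'
  have hVY := hasDerivAt_VYE hud hud'
  have htrig : HasDerivAt (fun x => 2 * Real.sin (SXE u P x x) * VXE u x + 2 * Real.sin (SYE u P x x) * VYE u x)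
      (2 * (Real.cos (SXE u P x x) * (2 * VXE u x) * VXE u x + Real.sin (SXE u P x x) * (deriv (deriv u) x * Real.cos x - 2 * deriv u x * Real.sin x - u x * Real.cos x)) +
        2 * (Real.cos (SYE u P x x) * (2 * VYE u x) * VYE u x + Real.sin (SYE u P x x) * (deriv (deriv u) x * Real.sin x + 2 * deriv u x * Real.cos x - u x * Real.sin x))) x := by
    have h := ((hX.sin.mul hVX).const_mul 2).add ((hY.sin.mul hVY).const_mul 2)
    refine (h.congr_deriv ?_).congr_of_eventuallyEq (Filter.Eventually.of_forall fun z => ?_)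
    · ring
    · simp only [Pi.add_apply, Pi.mul_apply]; ring
  have hmom : HasDerivAt (fun x => momE u P x x) ((2 : ℝ) • ![VXE u x, VYE u x]) x := by
    refine hasDerivAt_pi.2 fun i => ?_
    fin_cases i
    · show HasDerivAt (fun x => SXE u P x x) (2 * VXE u x) x
      exact hX
    · show HasDerivAt (fun x => SYE u P x x) (2 * VYE u x) x
      exact hY
  have hc : HasDerivAt (fun x => fderiv ℝ δ (momE u P x x))
      (fderiv ℝ (fderiv ℝ δ) (momE u P x x) ((2 : ℝ) • ![VXE u x, VYE u x])) x :=
    HasFDerivAt.comp_hasDerivAt (f := fun y => momE u P y y) x hδ'd.hasFDerivAt hmom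
  have hv := hasDerivAt_velocity hud hud'
  have hpert := hc.clm_apply hv
  have h := (htrig.add hpert).const_mul 2
  refine (h.congr_deriv ?_).congr_of_eventuallyEq (Filter.Eventually.of_forall fun z => ?_)
  · rw [map_smul, smul_apply, smul_eq_mul]; ring
  · simp only [h3E, Pi.add_apply]

end Fibres

end Summit.HubbardSuperconductivity.HubbardSuperconductivity.Theorems.PerturbedFermiCurve

end
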